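import Literature.Computability.Complexity.GapE3CNFToLabelCover
import Literature.Computability.Complexity.DartTables
import Literature.Computability.Complexity.CodeFPFinite
import Literature.Computability.Complexity.CodeFPLists
import HarnessLib

/-!
# The one-shot reduction from gap-E3SAT to gap label cover: arithmetic form and polynomial-time machine

Topic `Computability/Complexity`, namespace `Literature.Computability.Complexity.Expander.E3LC` (with generic
additions under `…Expander.RotGraph`, `…Expander.DegreeReduction`, `…CodeFP`).  The machine level of
`GapE3CNFToLabelCover.lean` in four parts (originally four files, merged for landing):

1. **neighbours** — the rotation map of `graph ψ` unfolded into `nbrN ψ : ℕ → ℕ → ℕ` (`nbrN_eq`);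
2. **dart constraints** — through finite descriptors, `cons ψ v i = relOfDesc (descN ψ v i)` and
   `accNat_eq_accOfDesc`;
3. **programs** — typed polynomial-time programs (`CodeFP.lean`) for all of the above on `encodingCNF` codes;
4. **the instance map** — `e3Inst_codeFP : ∃ f ∈ FP, ∀ ψ, f (code ψ) = code (e3Inst ε₁ ε' ψ)` and
   **`isNPHard_gapLabelCover_forall_of_gapE3SAT_hard`**: NP-hardness of `gapE3SAT (1/8 - ε₁)` (`0 < ε₁ ≤ 1/8`)
   alone gives `∀ ε > 0, ∃ W, (gapLabelCover W ε).IsNPHard` (Arora–Barak Thm. 22.15 in the tree's form).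

The four original module docstrings follow in place.

## References

* S. Arora, B. Barak, *Computational Complexity: A Modern Approach*, CUP 2009, §1.3, §22.A, Thm. 22.15.
-/


/-!
# The constraint graph of an E3-CNF in arithmetic form, I: neighbours

Topic `Computability/Complexity`, namespace `Literature.Computability.Complexity.Expander.E3LC`.  For the
polynomial-time machine of the one-shot reduction (`GapE3CNFToLabelCover.lean`), the rotation map of
`graph ψ = exGraph (edges ψ)` — a union of thickenings of the occurrence matching, of the cloud graph with
complete clouds, and of the complete graph (`OneShotPreprocessing.lean`, `CompleteRotGraphs.lean`,
`DegreeReductionGraph.lean`) — is unfolded into a total function `nbrN ψ : ℕ → ℕ → ℕ` written with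
`+, -, *, /, %`, comparisons, and three list operations on the vertex numbers `v = b + 2 s'`
(`s' < 3m` the binary constraint, `b` the endpoint): the cloud `cloudN ψ u` (the increasing list of the
vertices whose old variable is `u`), the position `posN` of a vertex in its cloud, and indexing into a cloud.

* `endpointN`, `partnerN`, `cloudN`, `posN`, `ccStep`, `xStepN`, `osNbrN`, **`nbrN`**;
* the correspondence lemmas `val_finProdFinEquiv_occ`, `endpoint_val`, `map_occList_val`, `cloud_map_val`,
  `pos_eq_posN`, `xStep_val`, and **`nbrN_eq`**: `nbrN ψ v i = (graph ψ).nbr v i` on `v < N ψ`, `i < D ψ`.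

## References

* S. Arora, B. Barak, *Computational Complexity: A Modern Approach*, CUP 2009, §22.A (Claims 22.36–22.38),
  §1.3 (arithmetic on indices is polynomial time).
-/

namespace Literature.Computability.Complexity

open Finset

/-- `idxOf` is preserved by injective maps. [folklore] -/
theorem List.idxOf_map_of_injective {α β : Type*} [BEq α] [LawfulBEq α] [BEq β] [LawfulBEq β] {f : α → β}
    (hf : Function.Injective f) (a : α) : ∀ l : List α, (l.map f).idxOf (f a) = l.idxOf a
  | [] => rfl
  | b :: l => by
    have ih := List.idxOf_map_of_injective hf a l
    by_cases h : b = a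
    · subst h; simp
    · have h' : ¬ f b = f a := fun heq => h (hf heq)
      rw [List.map_cons, List.idxOf_cons_ne _ h', List.idxOf_cons_ne _ h, ih]

namespace Expander

namespace RotGraph

variable {n d d₁ d₂ : ℕ}

/-- Neighbours in a union, by the numerical label. [folklore] -/
theorem union_nbr_val (G₁ : RotGraph n d₁) (G₂ : RotGraph n d₂) (v : Fin n) (i : Fin (d₁ + d₂)) :
    (G₁.union G₂).nbr v i = if h : i.val < d₁ then G₁.nbr v ⟨i.val, h⟩ else G₂.nbr v ⟨i.val - d₁, by lia⟩ := by
  induction i using Fin.addCases with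
  | left j => rw [union_nbr_castAdd, dif_pos (by simp)]; rfl
  | right j =>
    rw [union_nbr_natAdd, dif_neg (by simp)]
    congr 1
    exact Fin.ext (by simp)

/-- Neighbours in a thickening, by the numerical label (`c ≥ 1`). [folklore] -/
theorem thick_nbr_val (G : RotGraph n d) {c : ℕ} (hc : 0 < c) (v : Fin n) (i : Fin (d * c)) :
    (G.thick c).nbr v i = G.nbr v ⟨i.val / c, (Nat.div_lt_iff_lt_mul hc).2 i.isLt⟩ := by
  have h : i = finProdFinEquiv (⟨i.val / c, (Nat.div_lt_iff_lt_mul hc).2 i.isLt⟩, ⟨i.val % c, Nat.mod_lt _ hc⟩) :=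
    Fin.ext (by rw [finProdFinEquiv_apply_val]; exact (Nat.mod_add_div _ _).symm)
  conv_lhs => rw [h]
  rw [thick_nbr]

end RotGraph

namespace DegreeReduction

variable {n₀ m d₀ : ℕ} (e : Fin m → Fin n₀ × Fin n₀) (X : (k : ℕ) → RotGraph k d₀)

/-- The vertex number of an occurrence `(s, b)` is `b + 2 s`. [folklore] -/
theorem val_finProdFinEquiv_occ (o : Occ m) : (finProdFinEquiv o).val = o.2.val + 2 * o.1.val :=
  finProdFinEquiv_apply_val o

/-- Decoding a vertex number: `(v / 2, v % 2)`. [folklore] -/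
theorem finProdFinEquiv_symm_val (v : Fin (m * 2)) :
    ((finProdFinEquiv.symm v).1.val = v.val / 2) ∧ ((finProdFinEquiv.symm v).2.val = v.val % 2) := by
  simp

/-- **The partner vertex**: `v + 1` for even `v`, `v - 1` for odd `v`. [folklore] -/
def partnerN (v : ℕ) : ℕ := if v % 2 = 0 then v + 1 else v - 1

/-- The partner of a vertex has number `partnerN`. [folklore] -/
theorem val_partner (v : Fin (m * 2)) : (finProdFinEquiv (partner (finProdFinEquiv.symm v))).val = partnerN v.val := by
  rw [val_finProdFinEquiv_occ]
  unfold partner partnerN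
  simp only [Fin.val_rev]
  have h1 := (finProdFinEquiv_symm_val v).1
  have h2 := (finProdFinEquiv_symm_val v).2
  rw [h1, h2]
  have := Nat.mod_add_div v.val 2
  have hb : v.val % 2 < 2 := Nat.mod_lt _ (by norm_num)
  split_ifs with h <;> lia

/-- Pairing a list of constraints with the two endpoints, by vertex number. [folklore] -/
theorem map_product_zero_one_val (L : List (Fin m)) :
    (L ×ˢ ([0, 1] : List (Fin 2))).map (fun o => (finProdFinEquiv o).val) = (L.map fun s => [2 * s.val, 2 * s.val + 1]).flatten := by
  induction L with
  | nil => rfl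
  | cons s L ih =>
    rw [List.product_cons, List.map_append, ih]
    show [(finProdFinEquiv (s, (0 : Fin 2))).val, (finProdFinEquiv (s, (1 : Fin 2))).val] ++ (L.map fun s => [2 * s.val, 2 * s.val + 1]).flatten =
      [2 * s.val, 2 * s.val + 1] ++ (L.map fun s => [2 * s.val, 2 * s.val + 1]).flatten
    rw [val_finProdFinEquiv_occ, val_finProdFinEquiv_occ]
    simp
    lia

/-- The occurrences, by vertex number, are `0, 1, …, 2m - 1`. [folklore] -/
theorem map_occList_val : (occList m).map (fun o => (finProdFinEquiv o).val) = List.range (m * 2) := by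
  unfold occList
  rw [map_product_zero_one_val, List.map_finRange_eq_map_range (fun s : Fin m => [2 * s.val, 2 * s.val + 1]) (fun s => [2 * s, 2 * s + 1]) fun _ => rfl]
  conv_rhs => rw [← List.map_id (List.range (m * 2)), List.map_range_mul m 2 _root_.id]
  congr 1
  refine List.map_congr_left fun x _ => ?_
  simp [List.range_succ]
  lia

end DegreeReduction

namespace E3LC

open RotGraph DegreeReduction ArityReduction

variable (ψ : CNF ℕ)

/-! ### The arithmetic renderings -/

/-- The number of variables of `bcsp ψ`: the CNF variables and the dummy. [cite: AroraBarakCC2009, §11.3.1] -/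
abbrev nV : ℕ := ψ.numVars + 1

/-- The variable read at position `j` of clause `s` (as `clauseCons` reads it: clipped, dummy if absent). [cite: AroraBarakCC2009, §11.3.1] -/
def varOfN (s j : ℕ) : ℕ :=
  if j < (ψ.getD s []).length then min ((ψ.getD s []).getD j (0, false)).1 ψ.numVars else ψ.numVars

/-- **The old variable of the vertex `v = b + 2 s'`**: the clause-variable `y_{s'/3}` (numbered `nV + s'/3`) for
`b = 0`, the CNF variable at position `s' mod 3` of clause `s'/3` for `b = 1`. [cite: AroraBarakCC2009, Claims 22.36–22.37] -/
def endpointN (v : ℕ) : ℕ := if v % 2 = 0 then nV ψ + v / 2 / 3 else varOfN ψ (v / 2 / 3) (v / 2 % 3)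

/-- **The cloud of the old variable `u`**: the increasing list of the vertices carrying it. [cite: AroraBarakCC2009, Claim 22.37 (the cloud y_u^1, …, y_u^k)] -/
def cloudN (u : ℕ) : List ℕ := (List.range (N ψ)).filter fun v => endpointN ψ v = u

/-- The position of a vertex in its cloud. [cite: AroraBarakCC2009, Claim 22.37] -/
def posN (v : ℕ) : ℕ := (cloudN ψ (endpointN ψ v)).idxOf v

omit ψ in
/-- The move of the complete cloud graph `cc k K` from position `p` along label `j` (`CompleteRotGraphs.cc`). [folklore] -/
def ccStep (k K p j : ℕ) : ℕ := if j < K / k * k then (p + j % k) % k else p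

/-- **The expander dart `j` out of the vertex `v`**: the vertex at position `ccStep` of the cloud of `v`. [cite: AroraBarakCC2009, Claim 22.37] -/
def xStepN (v j : ℕ) : ℕ := (cloudN ψ (endpointN ψ v)).getD (ccStep (cloudN ψ (endpointN ψ v)).length (N ψ) (posN ψ v) j) v

/-- **Neighbours in `osGraph`** (label `i₀ < N + (N + 1)`): the partner on the thickened matching and on label `N`,
the expander darts above. [cite: AroraBarakCC2009, Claim 22.37] -/
def osNbrN (v i₀ : ℕ) : ℕ :=
  if i₀ < N ψ then partnerN v else if i₀ - N ψ = 0 then partnerN v else xStepN ψ v (i₀ - N ψ - 1)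

/-- **Neighbours in `graph ψ`** (label `i < D ψ`): `osGraph` thickened `N` times, then the complete graph thickened
`osD` times. [cite: AroraBarakCC2009, Claims 22.37–22.38] -/
def nbrN (v i : ℕ) : ℕ :=
  if i < osD (m₁ ψ) * N ψ then osNbrN ψ v (i / N ψ) else (v + (i - osD (m₁ ψ) * N ψ) / osD (m₁ ψ)) % N ψ

/-! ### Correspondence with the `Fin`-indexed definitions -/

/-- The binary constraint `s'` reads clause `s'/3` at position `s' mod 3`. [folklore] -/
theorem finProdFinEquiv_symm_three (x : Fin (m₁ ψ)) :
    ((finProdFinEquiv.symm x).1.val = x.val / 3) ∧ ((finProdFinEquiv.symm x).2.val = x.val % 3) := ⟨rfl, rfl⟩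

/-- **`endpoint` is `endpointN`.** [cite: AroraBarakCC2009, Claims 22.36–22.37] -/
theorem endpoint_val (o : Occ (m₁ ψ)) : (endpoint (edges ψ) o).val = endpointN ψ (finProdFinEquiv o).val := by
  obtain ⟨x, b⟩ := o
  rw [val_finProdFinEquiv_occ]
  unfold endpointN endpoint edges arEdge
  simp only
  have hb2 : (b.val + 2 * x.val) % 2 = b.val := by rw [Nat.add_mul_mod_self_left, Nat.mod_eq_of_lt b.isLt]
  have hd2 : (b.val + 2 * x.val) / 2 = x.val := by
    rw [Nat.add_mul_div_left _ _ (by norm_num), Nat.div_eq_of_lt b.isLt, Nat.zero_add]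
  rw [hb2, hd2]
  have h1 := (finProdFinEquiv_symm_three ψ x).1
  have h2 := (finProdFinEquiv_symm_three ψ x).2
  by_cases hb : b = 0
  · subst hb
    simp only [Fin.isValue, ↓reduceIte, Fin.val_zero]
    unfold newVar
    rw [finSumFinEquiv_apply_right, Fin.val_natAdd, h1]
    rfl
  · have hb1 : b = 1 := Fin.eq_one_of_ne_zero b hb
    subst hb1
    simp only [Fin.isValue, one_ne_zero, ↓reduceIte, Fin.val_one]
    unfold newVar
    rw [finSumFinEquiv_apply_left, Fin.val_castAdd]
    -- the variable read by `clauseCons`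
    unfold BCSP.vars
    rw [BCSP.ofCNF_cons_getElem]
    unfold BCSP.clauseCons varOfN
    simp only
    have hget : ψ.getD (x.val / 3) [] = ψ[(finProdFinEquiv.symm x).1.val]'(BCSP.lt_length_of_fin 3 _) := by
      rw [List.getD_eq_getElem _ _ (by rw [← h1]; exact BCSP.lt_length_of_fin 3 _)]
      simp only [h1]
    rw [hget, ← h2]
    split_ifs with hj
    · rw [List.getD_eq_getElem _ _ hj]
    · rfl

/-- **The cloud, by vertex numbers, is `cloudN`.** [cite: AroraBarakCC2009, Claim 22.37] -/
theorem cloud_map_val (u : Fin (n₀ ψ)) : (cloud (edges ψ) u).map (fun o => (finProdFinEquiv o).val) = cloudN ψ u.val := by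
  unfold cloud cloudN
  rw [show N ψ = m₁ ψ * 2 from rfl, ← map_occList_val, List.filter_map]
  congr 1
  refine List.filter_congr fun o _ => ?_
  simp only [Function.comp_apply, decide_eq_decide]
  rw [← endpoint_val]
  exact Fin.val_inj.symm

/-- Hence the cloud sizes agree. [folklore] -/
theorem length_cloudN (u : Fin (n₀ ψ)) : (cloudN ψ u.val).length = (cloud (edges ψ) u).length := by
  rw [← cloud_map_val, List.length_map]

/-- **`pos` is `posN`.** [cite: AroraBarakCC2009, Claim 22.37] -/
theorem pos_eq_posN (o : Occ (m₁ ψ)) : pos (edges ψ) o = posN ψ (finProdFinEquiv o).val := by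
  unfold pos posN
  rw [← endpoint_val, ← cloud_map_val]
  exact (List.idxOf_map_of_injective (fun a b h => finProdFinEquiv.injective (Fin.ext h)) o _).symm

/-- The first component of `xrot` for the complete clouds is `ccStep`. [folklore] -/
theorem xrot_cc_fst {k p : ℕ} (hp : p < k) (j : Fin (m₁ ψ * 2)) :
    (xrot (fun k => cc k (m₁ ψ * 2)) k p j).1 = ccStep k (N ψ) p j.val := by
  unfold xrot ccStep
  rw [dif_pos hp]
  show ((cc k (m₁ ψ * 2)).nbr ⟨p, hp⟩ j).val = _
  by_cases h : j.val < m₁ ψ * 2 / k * k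
  · rw [cc_nbr_of_lt _ _ h, if_pos h]
  · rw [cc_nbr_of_le _ _ (Nat.not_lt.1 h), if_neg h]

/-- **The expander step is `xStepN`.** [cite: AroraBarakCC2009, Claim 22.37] -/
theorem xStep_val (o : Occ (m₁ ψ)) (j : Fin (m₁ ψ * 2)) :
    (finProdFinEquiv (xStep (edges ψ) (fun k => cc k (m₁ ψ * 2)) o j).1).val = xStepN ψ (finProdFinEquiv o).val j.val := by
  unfold xStep xStepN
  simp only
  rw [← endpoint_val, ← cloud_map_val, List.getD_map, ← pos_eq_posN, List.length_map, xrot_cc_fst ψ (pos_lt _ o)]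

/-- `finProdFinEquiv` after `symm`, on values. [folklore] -/
theorem val_occ_of_vertex (v : Fin (N ψ)) : (finProdFinEquiv (finProdFinEquiv.symm v)).val = v.val := by
  rw [Equiv.apply_symm_apply]

/-- **Neighbours in `osGraph` are `osNbrN`.** [cite: AroraBarakCC2009, Claim 22.37] -/
theorem osNbr_val (v : Fin (N ψ)) (i₀ : Fin (1 * (m₁ ψ * 2) + (m₁ ψ * 2 + 1))) :
    ((osGraph (edges ψ)).nbr v i₀).val = osNbrN ψ v.val i₀.val := by
  have hK : 0 < m₁ ψ * 2 := v.pos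
  unfold osGraph osNbrN
  rw [union_nbr_val]
  by_cases h : i₀.val < 1 * (m₁ ψ * 2)
  · rw [dif_pos h, if_pos (by rw [show N ψ = m₁ ψ * 2 from rfl]; lia), thick_nbr_val _ hK]
    have hz : (⟨i₀.val / (m₁ ψ * 2), (Nat.div_lt_iff_lt_mul hK).2 h⟩ : Fin (0 + 1)) = 0 :=
      Fin.ext (by have := (Nat.div_lt_iff_lt_mul hK).2 h; simp only [Fin.val_zero]; lia)
    rw [hz, reduced_nbr_zero, val_partner]
  · rw [dif_neg h, if_neg (by rw [show N ψ = m₁ ψ * 2 from rfl]; lia)]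
    have hN : N ψ = m₁ ψ * 2 := rfl
    set i₁ : Fin (m₁ ψ * 2 + 1) := ⟨i₀.val - 1 * (m₁ ψ * 2), by have := i₀.isLt; lia⟩ with hi₁
    have hi₁v : i₁.val = i₀.val - N ψ := by rw [hi₁, hN]; simp
    rcases Fin.eq_zero_or_eq_succ i₁ with h0 | ⟨j, hj⟩
    · have : i₀.val - N ψ = 0 := by rw [← hi₁v, h0]; rfl
      rw [if_pos this, h0, reduced_nbr_zero, val_partner]
    · have : i₀.val - N ψ = j.val + 1 := by rw [← hi₁v, hj]; rfl
      rw [if_neg (by rw [this]; exact Nat.succ_ne_zero _), hj, reduced_nbr_succ, xStep_val, val_occ_of_vertex]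
      congr 1
      rw [this]
      rfl

/-- **Neighbours in `graph ψ` are `nbrN`.** [cite: AroraBarakCC2009, Claims 22.37–22.38] -/
theorem nbrN_eq (v : Fin (N ψ)) (i : Fin (D ψ)) : nbrN ψ v.val i.val = ((graph ψ).nbr v i).val := by
  have hK : 0 < m₁ ψ * 2 := v.pos
  have hD : 0 < osD (m₁ ψ) := by unfold osD; positivity
  unfold graph exGraph nbrN
  rw [union_nbr_val]
  by_cases h : i.val < osD (m₁ ψ) * (m₁ ψ * 2)
  · rw [dif_pos h, if_pos h, thick_nbr_val _ hK, osNbr_val]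
  · rw [dif_neg h, if_neg h, thick_nbr_val _ hD, cc_self_nbr]

end E3LC

end Expander

end Literature.Computability.Complexity


/-!
# The constraint graph of an E3-CNF in arithmetic form, II: the dart constraints through finite descriptors

Topic `Computability/Complexity`, namespace `Literature.Computability.Complexity.Expander.E3LC`.  The dart
constraints `cons ψ v i : ℕ → ℕ → Bool` of the one-shot graph (`GapE3CNFToLabelCover.lean`) are relations on
the alphabet `[8]`; what the machine needs about them is the list of accepting pairs
(`DartTables.accNat`).  Each constraint is one of four kinds — the arity-reduction relation of
Arora–Barak Claim 22.36 read forwards or backwards (on the matching darts), equality (on the cloud darts),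
always-true (on the complete-graph darts) — and a forwards/backwards relation depends only on the clause
(its length clipped at `3` and its three polarities) and on the position read.  So:

* `Desc = Fin 4 × Fin 4 × (Bool × Bool × Bool) × Fin 3` — kind, clipped length, polarities, position;
  `relOfDesc`, `accOfDesc` — the relation and accepting-pair list of a descriptor, written with the very
  functions of `ArityReduction.lean` (`dec`, `bit`);
* `kindN`, `descN ψ v i` — the descriptor of the dart `(v, i)` in arithmetic form (label ranges as in
  `E3GraphNbr.nbrN`, clause lookups by `getD`);
* `cons_eq_relOfDesc` — **`cons ψ v i = relOfDesc (descN ψ v i)`** (for `v < N ψ`, `i < D ψ`), hence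
  `accNat_eq_accOfDesc`: the acceptance data of `DartTables` is `accOfDesc ∘ descN`;
* `accNat_eq_filter_range` — `accNat C 8 v i` as a filter of `range 8 ×ˢ range 8` (generic).

## References

* S. Arora, B. Barak, *Computational Complexity: A Modern Approach*, CUP 2009, §22.A (Claims 22.36–22.38).
-/

namespace Literature.Computability.Complexity

open Finset

namespace Expander

namespace RotGraph

variable {n d d₁ d₂ : ℕ}

/-- `unionC` by the numerical label. [folklore] -/
theorem unionC_val (C₁ : Fin n → Fin d₁ → ℕ → ℕ → Bool) (C₂ : Fin n → Fin d₂ → ℕ → ℕ → Bool) (v : Fin n) (i : Fin (d₁ + d₂)) :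
    unionC C₁ C₂ v i = if h : i.val < d₁ then C₁ v ⟨i.val, h⟩ else C₂ v ⟨i.val - d₁, by lia⟩ := by
  induction i using Fin.addCases with
  | left j => rw [unionC_castAdd, dif_pos (by simp)]; rfl
  | right j =>
    rw [unionC_natAdd, dif_neg (by simp)]
    congr 1
    exact Fin.ext (by simp)

/-- `thickC` by the numerical label (`c ≥ 1`). [folklore] -/
theorem thickC_val (C : Fin n → Fin d → ℕ → ℕ → Bool) {c : ℕ} (hc : 0 < c) (v : Fin n) (i : Fin (d * c)) :
    thickC C c v i = C v ⟨i.val / c, (Nat.div_lt_iff_lt_mul hc).2 i.isLt⟩ := rfl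

/-- The accepting pairs over `[8]²` as a filter of `range 8 ×ˢ range 8`. [folklore] -/
theorem accNat_eq_filter_range (C : Fin n → Fin d → ℕ → ℕ → Bool) (v : Fin n) (i : Fin d) :
    accNat C 8 v i = ((List.range 8) ×ˢ (List.range 8)).filter fun p => C v i p.1 p.2 := by
  unfold accNat accPairs
  have h : ((List.finRange 8) ×ˢ (List.finRange 8)).map (fun p : Fin 8 × Fin 8 => (p.1.val, p.2.val)) = (List.range 8) ×ˢ (List.range 8) := by
    decide
  rw [← h, List.filter_map]
  rfl

end RotGraph

namespace E3LC

open RotGraph DegreeReduction ArityReduction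

/-! ### Descriptors -/

/-- **Descriptors of dart constraints**: kind (`0` forwards, `1` backwards, `2` equality, `3` true), clause
length clipped at `3`, the three polarities, the position read. [cite: AroraBarakCC2009, Claims 22.36–22.38] -/
abbrev Desc : Type := Fin 4 × Fin 4 × (Bool × Bool × Bool) × Fin 3

/-- The polarity at a position. [folklore] -/
def polAt (pols : Bool × Bool × Bool) (i : Fin 3) : Bool := Fin.cases pols.1 (fun i => Fin.cases pols.2.1 (fun _ => pols.2.2) i) i

/-- The acceptance predicate of a clipped clause on local assignments `Fin 3 → Bool`. [cite: AroraBarakCC2009, §11.3.1 (the constraint of a clause)] -/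
def accOf (len : Fin 4) (pols : Bool × Bool × Bool) (τ : Fin 3 → Bool) : Bool :=
  decide (∃ i : Fin 3, i.val < len.val ∧ τ i = polAt pols i)

/-- The forwards relation of a descriptor (`arRel` with the synthetic acceptance predicate). [cite: AroraBarakCC2009, Claim 22.36 (ψ_{i,j})] -/
def relFwd (len : Fin 4) (pols : Bool × Bool × Bool) (j : Fin 3) (a b : ℕ) : Bool :=
  if h : a < 2 ^ 3 then accOf len pols (ArityReduction.dec a h) && decide (b = bit (ArityReduction.dec a h j)) else false

/-- **The relation of a descriptor.** [cite: AroraBarakCC2009, Claims 22.36–22.38] -/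
def relOfDesc (δ : Desc) (a b : ℕ) : Bool :=
  Fin.cases (relFwd δ.2.1 δ.2.2.1 δ.2.2.2 a b)
    (fun k => Fin.cases (relFwd δ.2.1 δ.2.2.1 δ.2.2.2 b a) (fun k => Fin.cases (decide (a = b)) (fun _ => true) k) k) δ.1

/-- **The accepting pairs of a descriptor** over `[8]²`. [folklore] -/
def accOfDesc (δ : Desc) : List (ℕ × ℕ) := ((List.range 8) ×ˢ (List.range 8)).filter fun p => relOfDesc δ p.1 p.2

/-! ### The descriptor of a dart -/

variable (ψ : CNF ℕ)

/-- The kind of the label `i` at a vertex with endpoint bit `b`: matching darts are forwards (`b = 0`) or backwards,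
cloud darts equality, complete-graph darts true. [cite: AroraBarakCC2009, Claims 22.37–22.38] -/
def kindN (b i : ℕ) : Fin 4 :=
  if i < osD (m₁ ψ) * N ψ then
    (if i / N ψ < N ψ then (if b = 0 then 0 else 1) else if i / N ψ - N ψ = 0 then (if b = 0 then 0 else 1) else 2)
  else 3

/-- The clipped length of clause `s`. [folklore] -/
def lenN (s : ℕ) : Fin 4 := ⟨min (ψ.getD s []).length 3, Nat.lt_succ_of_le (min_le_right _ _)⟩

/-- The three polarities of clause `s` (junk `false` beyond its length). [folklore] -/
def polsN (s : ℕ) : Bool × Bool × Bool :=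
  (((ψ.getD s []).getD 0 (0, false)).2, ((ψ.getD s []).getD 1 (0, false)).2, ((ψ.getD s []).getD 2 (0, false)).2)

/-- **The descriptor of the dart `(v, i)`.** [cite: AroraBarakCC2009, Claims 22.36–22.38] -/
def descN (v i : ℕ) : Desc := (kindN ψ (v % 2) i, lenN ψ (v / 2 / 3), polsN ψ (v / 2 / 3), ⟨v / 2 % 3, Nat.mod_lt _ (by norm_num)⟩)

/-! ### Correspondence -/

/-- The acceptance predicate of `bcsp ψ` at clause `s` is `accOf (lenN s) (polsN s)`. [cite: AroraBarakCC2009, §11.3.1] -/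
theorem acc_bcsp_eq (s : Fin (bcsp ψ).cons.length) (τ : Fin 3 → Bool) :
    (bcsp ψ).acc s τ = accOf (lenN ψ s.val) (polsN ψ s.val) τ := by
  unfold BCSP.acc
  rw [BCSP.ofCNF_cons_getElem]
  unfold BCSP.clauseCons accOf
  simp only [decide_eq_decide]
  have hget : ψ.getD s.val [] = ψ[s.val]'(BCSP.lt_length_of_fin 3 s) := List.getD_eq_getElem _ _ _
  constructor
  · rintro ⟨i, hi, h⟩
    refine ⟨i, ?_, ?_⟩
    · show i.val < min (ψ.getD s.val []).length 3
      rw [hget]; exact lt_min hi i.isLt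
    · rw [h]
      unfold polsN polAt
      rw [hget]
      have hi3 := i.isLt
      rcases Fin.eq_zero_or_eq_succ i with h0 | ⟨i', hi'⟩
      · subst h0; simp only [Fin.cases_zero, Fin.val_zero] at hi ⊢; rw [List.getD_eq_getElem _ _ hi]
      · subst hi'
        rcases Fin.eq_zero_or_eq_succ i' with h0 | ⟨i'', hi''⟩
        · subst h0; simp only [Fin.cases_succ, Fin.cases_zero, Fin.val_succ, Fin.val_zero] at hi ⊢; rw [List.getD_eq_getElem _ _ hi]
        · subst hi''
          have : i'' = 0 := Fin.fin_one_eq_zero i''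
          subst this
          simp only [Fin.cases_succ, Fin.val_succ, Fin.val_zero] at hi ⊢; rw [List.getD_eq_getElem _ _ hi]
  · rintro ⟨i, hi, h⟩
    have hi' : i.val < min (ψ.getD s.val []).length 3 := hi
    rw [hget] at hi'
    have hic : i.val < (ψ[s.val]'(BCSP.lt_length_of_fin 3 s)).length := lt_of_lt_of_le hi' (min_le_left _ _)
    refine ⟨i, hic, ?_⟩
    rw [h]
    unfold polsN polAt
    rw [hget]
    rcases Fin.eq_zero_or_eq_succ i with h0 | ⟨i', hi'⟩
    · subst h0; simp only [Fin.cases_zero, Fin.val_zero] at hic ⊢; rw [List.getD_eq_getElem _ _ hic]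
    · subst hi'
      rcases Fin.eq_zero_or_eq_succ i' with h0 | ⟨i'', hi''⟩
      · subst h0; simp only [Fin.cases_succ, Fin.cases_zero, Fin.val_succ, Fin.val_zero] at hic ⊢; rw [List.getD_eq_getElem _ _ hic]
      · subst hi''
        have : i'' = 0 := Fin.fin_one_eq_zero i''
        subst this
        simp only [Fin.cases_succ, Fin.val_succ, Fin.val_zero] at hic ⊢; rw [List.getD_eq_getElem _ _ hic]

/-- **The matching relation is `relFwd`**: `rel ψ x a b = relFwd (lenN (x/3)) (polsN (x/3)) (x mod 3) a b`. [cite: AroraBarakCC2009, Claim 22.36] -/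
theorem rel_eq_relFwd (x : Fin (m₁ ψ)) (a b : ℕ) :
    rel ψ x a b = relFwd (lenN ψ (x.val / 3)) (polsN ψ (x.val / 3)) ⟨x.val % 3, Nat.mod_lt _ (by norm_num)⟩ a b := by
  unfold rel arR arRel relFwd
  have h1 := (finProdFinEquiv_symm_three ψ x).1
  have h2 : (finProdFinEquiv.symm x).2 = ⟨x.val % 3, Nat.mod_lt _ (by norm_num)⟩ := Fin.ext (finProdFinEquiv_symm_three ψ x).2
  simp only [acc_bcsp_eq, h1, h2]

/-- **The dart constraints are the relations of the descriptors** (`v < N ψ`, `i < D ψ`). [cite: AroraBarakCC2009, Claims 22.36–22.38] -/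
theorem cons_eq_relOfDesc (v : Fin (N ψ)) (i : Fin (D ψ)) (a b : ℕ) : cons ψ v i a b = relOfDesc (descN ψ v.val i.val) a b := by
  have hK : 0 < m₁ ψ * 2 := v.pos
  have hN : N ψ = m₁ ψ * 2 := rfl
  have hb := (finProdFinEquiv_symm_val v).2
  have hs := (finProdFinEquiv_symm_val v).1
  -- the matching relation at `v`, forwards or backwards
  have hmatch : ∀ d₀ : ℕ, reducedC (d₀ := d₀) (rel ψ) v 0 a b =
      relOfDesc ((if v.val % 2 = 0 then 0 else 1), lenN ψ (v.val / 2 / 3), polsN ψ (v.val / 2 / 3), ⟨v.val / 2 % 3, Nat.mod_lt _ (by norm_num)⟩) a b := by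
    intro d₀
    rw [reducedC_zero]
    by_cases h0 : (finProdFinEquiv.symm v).2 = 0
    · have : v.val % 2 = 0 := by rw [← hb, h0]; rfl
      rw [if_pos h0, if_pos this, rel_eq_relFwd, hs]
      rfl
    · have h1 : (finProdFinEquiv.symm v).2 = 1 := Fin.eq_one_of_ne_zero _ h0
      have : v.val % 2 ≠ 0 := by rw [← hb, h1]; exact one_ne_zero
      rw [if_neg h0, if_neg this, rel_eq_relFwd, hs]
      rfl
  unfold cons exC descN kindN
  rw [unionC_val]
  by_cases h : i.val < osD (m₁ ψ) * (m₁ ψ * 2)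
  · rw [dif_pos h, if_pos h, thickC_val _ hK]
    unfold osC
    rw [unionC_val]
    simp only
    by_cases h' : i.val / (m₁ ψ * 2) < 1 * (m₁ ψ * 2)
    · rw [dif_pos h', if_pos (by rw [hN]; lia), thickC_val _ hK]
      have hz : (⟨i.val / (m₁ ψ * 2) / (m₁ ψ * 2), (Nat.div_lt_iff_lt_mul hK).2 h'⟩ : Fin (0 + 1)) = 0 :=
        Fin.ext (by have := (Nat.div_lt_iff_lt_mul hK).2 h'; simp only [Fin.val_zero]; lia)
      rw [hz, hmatch]
    · rw [dif_neg h', if_neg (by rw [hN]; lia)]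
      set i₁ : Fin (m₁ ψ * 2 + 1) := ⟨i.val / (m₁ ψ * 2) - 1 * (m₁ ψ * 2), _⟩ with hi₁
      have hi₁v : i₁.val = i.val / N ψ - N ψ := by rw [hi₁, hN]; simp
      rcases Fin.eq_zero_or_eq_succ i₁ with h0 | ⟨j, hj⟩
      · have : i.val / N ψ - N ψ = 0 := by rw [← hi₁v, h0]; rfl
        rw [if_pos this, h0, hmatch]
      · have : i.val / N ψ - N ψ = j.val + 1 := by rw [← hi₁v, hj]; rfl
        rw [if_neg (by rw [this]; exact Nat.succ_ne_zero _), hj, reducedC_succ]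
        rfl
  · rw [dif_neg h, if_neg h]
    rfl

/-- **The acceptance data is `accOfDesc ∘ descN`.** [cite: AroraBarakCC2009, Claims 22.36–22.38] -/
theorem accNat_eq_accOfDesc (v : Fin (N ψ)) (i : Fin (D ψ)) : accNat (cons ψ) 8 v i = accOfDesc (descN ψ v.val i.val) := by
  rw [accNat_eq_filter_range]
  unfold accOfDesc
  exact List.filter_congr fun p _ => by rw [cons_eq_relOfDesc]

end E3LC

end Expander

end Literature.Computability.Complexity


/-!
# The constraint graph of an E3-CNF on codes: neighbours and acceptance data in polynomial time

Topic `Computability/Complexity`, namespace `Literature.Computability.Complexity.Expander.E3LC`.  The typed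
polynomial-time programs (`CodeFP.lean`) computing, from the code of a CNF `ψ` (`encodingCNF`, i.e.
`listE (listE (pairE natE bitE))`) and binary indices, the arithmetic renderings of `E3GraphNbr.lean` and
`E3GraphAcc.lean`: `numVars`, `varOfN`, `endpointN`, the sizes `N ψ`, `D ψ` (binary and unary), `cloudN`,
`posN`, `xStepN`, `nbrN`, the descriptor `descN` and — through the finite table of `accOfDesc`
(`CodeFP.ofFintype`) — the acceptance data `accOfDesc (descN ψ v i)`.

Generic additions to the `CodeFP` toolkit proved here: `rawFilter` (filter as `flatten ∘ map`),
`idxOfNat` (`List.idxOf` on lists of numerals, through `rawEnum`), `unMul` (unary product), `natMaxList`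
(maximum of a list of numerals, a bounded fold).

## References

* S. Arora, B. Barak, *Computational Complexity: A Modern Approach*, CUP 2009, §1.3 (polynomial-time
  closure under composition and bounded loops).
-/

namespace Literature.Computability.Complexity

open _root_.Computability Polynomial

namespace CodeFP

variable {α β σ : Type} {eα : α → List Bool} {eβ : β → List Bool} {eσ : σ → List Bool}

/-! ### Generic additions -/

/-- `filter` is `flatten ∘ map (fun a => if p a then [a] else [])`. [folklore] -/
theorem filter_eq_flatten_map (p : α → Bool) (l : List α) : l.filter p = (l.map fun a => if p a then [a] else []).flatten := by
  induction l with
  | nil => rfl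
  | cons a l ih =>
    rw [List.filter_cons, List.map_cons, List.flatten_cons, ih]
    by_cases h : p a = true
    · simp [h]
    · simp [h]

/-- **Filtering a raw list by a computed test, with a context.** [cite: AroraBarak2009, §1.3] -/
theorem rawFilter {p : σ × α → Bool} (hp : CodeFP (pairE eσ eα) bitE p) :
    CodeFP (pairE eσ (rawE eα)) (rawE eα) (fun q => q.2.filter fun a => p (q.1, a)) := by
  have hitem : CodeFP (pairE eσ eα) (rawE eα) (fun t => if p t then [t.2] else []) :=
    (hp.ite ((rawSingleton eα).comp (snd _ _)) (const _ [])).congr fun _ => rfl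
  exact (((flatten eα).comp (map (σ := σ) (α := α) (g := fun t => if p t then [t.2] else []) hitem))).congr
    fun q => (filter_eq_flatten_map _ _).symm

/-- `idxOf` through the enumeration: the index of the first enumerated pair carrying `v`, else the length. [folklore] -/
theorem idxOf_eq_headD_filter_enum (v : ℕ) (l : List ℕ) :
    l.idxOf v = ((((List.range l.length).zip l).filter fun q => q.2 == v).headD (l.length, v)).1 := by
  suffices h : ∀ k : ℕ, k + l.idxOf v = ((((List.range' k l.length).zip l).filter fun q => q.2 == v).headD (k + l.length, v)).1 by
    simpa [List.range_eq_range'] using h 0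
  induction l with
  | nil => intro k; simp
  | cons a l ih =>
    intro k
    rw [List.length_cons, List.range'_succ, List.zip_cons_cons, List.filter_cons]
    by_cases h : a = v
    · subst h; simp
    · have hne : (a == v) = false := beq_false_of_ne h
      simp only [hne, Bool.false_eq_true, ↓reduceIte, List.idxOf_cons_ne _ h]
      have := ih (k + 1)
      rw [show k + 1 + l.length = k + (l.length + 1) by ring] at this
      rw [← this]
      lia

/-- **`List.idxOf` on a raw list of binary numerals** (`(v, l) ↦ l.idxOf v`). [cite: AroraBarak2009, §1.3] -/
theorem idxOfNat : CodeFP (pairE natE (rawE natE)) natE (fun p => p.2.idxOf p.1) := by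
  -- the filtered enumeration, with context `v`
  have henum : CodeFP (pairE natE (rawE natE)) (rawE (pairE natE natE)) (fun p => (List.range p.2.length).zip p.2) :=
    ((rawEnum natE).comp (snd _ _)).congr fun _ => rfl
  have htest : CodeFP (pairE natE (pairE natE natE)) bitE (fun t => t.2.2 == t.1) :=
    ((beq natE_injective).comp ((snd _ _).snd'.pair (fst _ _))).congr fun _ => rfl
  have hfilt : CodeFP (pairE natE (rawE natE)) (rawE (pairE natE natE))
      (fun p => ((List.range p.2.length).zip p.2).filter fun q => q.2 == p.1) :=
    ((rawFilter (σ := ℕ) (α := ℕ × ℕ) (p := fun t => t.2.2 == t.1) htest).comp ((fst _ _).pair henum)).congr fun _ => rfl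
  have hdef : CodeFP (pairE natE (rawE natE)) (pairE natE natE) (fun p => (p.2.length, p.1)) :=
    (((natLength natE).comp (snd _ _)).pair (fst _ _)).congr fun _ => rfl
  have hhead : CodeFP (pairE natE (rawE natE)) (pairE natE natE)
      (fun p => (((List.range p.2.length).zip p.2).filter fun q => q.2 == p.1).headD (p.2.length, p.1)) :=
    ((rawHeadOr (pairE natE natE)).comp (hdef.pair hfilt)).congr fun _ => rfl
  exact hhead.fst'.congr fun p => (idxOf_eq_headD_filter_enum p.1 p.2).symm

/-- **Unary product**: `(1ᵃ, 1ᵇ) ↦ 1^{ab}` (the length of `a` copies of `b` units). [cite: AroraBarak2009, §1.3] -/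
theorem unMul : CodeFP (pairE unE unE) unE (fun p => p.1 * p.2) := by
  have hcopies : CodeFP (pairE unE unE) (rawE (rawE unitE)) (fun p => (List.replicate p.1 ()).map fun _ => List.replicate p.2 ()) :=
    ((map (σ := ℕ) (α := Unit) (g := fun t => List.replicate t.1 ()) (replicateUnit.comp (fst _ _))).comp
      ((snd _ _).pair (replicateUnit.comp (fst _ _)))).congr fun _ => rfl
  exact (((ulength unitE).comp ((flatten unitE).comp hcopies))).congr fun p => by
    simp [List.map_replicate]

/-- The maximum fold from the left equals the one from the right. [folklore] -/
theorem foldl_max_eq_foldr : ∀ (l : List ℕ) (acc : ℕ), l.foldl max acc = max acc (l.foldr max 0)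
  | [], acc => by simp
  | a :: l, acc => by rw [List.foldl_cons, List.foldr_cons, foldl_max_eq_foldr l, max_assoc]

/-- A left maximum fold is `0` or a member. [folklore] -/
theorem foldl_max_mem_or (l : List ℕ) : l.foldl max 0 = 0 ∨ l.foldl max 0 ∈ l := by
  rw [foldl_max_eq_foldr l 0, Nat.zero_max]
  induction l with
  | nil => left; rfl
  | cons a l ih =>
    rw [List.foldr_cons]
    rcases le_total a (l.foldr max 0) with h | h
    · rw [max_eq_right h]
      rcases ih with h0 | hm
      · rw [h0] at h ⊢; left; rfl
      · right; exact List.mem_cons_of_mem _ hm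
    · rw [max_eq_left h]; right; exact List.mem_cons_self

/-- **The maximum of a raw list of numerals** (`foldr max 0`). [cite: AroraBarak2009, §1.3] -/
theorem natMaxList : CodeFP (rawE natE) natE (fun l => l.foldr max 0) := by
  have hstep : CodeFP (pairE natE natE) natE (fun t => max t.2 t.1) := (natMax.comp ((snd _ _).pair (fst _ _))).congr fun _ => rfl
  have h := foldl₀ (α := ℕ) (β := ℕ) (eα := natE) (eβ := natE) (step := fun a b => max b a) (b₀ := 0) hstep X fun l₁ l₂ => by
    rw [eval_X, show (l₁.foldl (fun b a => max b a) 0) = l₁.foldl max 0 from rfl]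
    rcases foldl_max_mem_or l₁ with h0 | hm
    · rw [h0]; exact (length_natE_le 0).trans (Nat.zero_le _)
    · have := length_item_le_length_rawE natE (List.mem_append_left l₂ hm)
      lia
  exact h.congr fun l => by rw [show (l.foldl (fun b a => max b a) 0) = l.foldl max 0 from rfl, foldl_max_eq_foldr l 0, Nat.zero_max]

end CodeFP

namespace Expander

namespace E3LC

open CodeFP RotGraph DegreeReduction

/-! ### Encoders -/

/-- The code of a CNF: `encodingCNF`, i.e. `listE (listE (pairE natE bitE))`. [cite: Cook1971, §1 (CNF codes)] -/
def cnfE : CNF ℕ → List Bool := listE (listE (pairE natE bitE))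

/-- `cnfE` is `encodingCNF.encode`. [folklore] -/
theorem cnfE_eq : (encodingCNF.encode : CNF ℕ → List Bool) = cnfE := by
  unfold cnfE encodingCNF encodingClause encodingLiteral
  rw [listE_eq, listE_eq, pairE_eq, natE_eq, bitE_eq]

/-- The literal code. [folklore] -/
abbrev litE : ℕ × Bool → List Bool := pairE natE bitE

/-! ### The formula: clauses, literals, `numVars` -/

/-- The clauses as a raw list of raw clauses. [cite: AroraBarak2009, §1.3] -/
theorem rawClausesFP : CodeFP cnfE (rawE (rawE litE)) (fun ψ => ψ) :=
  ((map₀ (rawOfList litE)).comp (rawOfList (listE litE))).congr fun ψ => by simp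

/-- The number of clauses (binary). [cite: AroraBarak2009, §1.3] -/
theorem lengthFP : CodeFP cnfE natE (fun ψ : CNF ℕ => ψ.length) :=
  ((natLength (listE litE)).comp (rawOfList (listE litE))).congr fun _ => rfl

/-- The number of clauses (unary). [cite: AroraBarak2009, §1.3] -/
theorem ulengthFP : CodeFP cnfE unE (fun ψ : CNF ℕ => ψ.length) :=
  ((ulength (listE litE)).comp (rawOfList (listE litE))).congr fun _ => rfl

/-- **`numVars`** (the bounded maximum of `l.1 + 1` over the literals). [cite: AroraBarak2009, §1.3] -/
theorem numVarsFP : CodeFP cnfE natE CNF.numVars := by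
  have hlits : CodeFP cnfE (rawE litE) (fun ψ : CNF ℕ => ψ.flatten) := ((flatten litE).comp rawClausesFP).congr fun _ => rfl
  have hitem : CodeFP litE natE (fun l : ℕ × Bool => l.1 + 1) := (natAdd.comp ((fst _ _).pair (const _ 1))).congr fun _ => rfl
  exact (natMaxList.comp ((map₀ hitem).comp hlits)).congr fun ψ => rfl

/-- The clause `ψ[s]` (raw; `[]` out of range), `s` binary. [cite: AroraBarak2009, §1.3] -/
theorem clauseFP : CodeFP (pairE cnfE natE) (rawE litE) (fun p => p.1.getD p.2 []) := by
  have h : CodeFP (pairE cnfE natE) (listE litE) (fun p => p.1.getD p.2 []) :=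
    ((rawGetOr (listE litE)).comp (((rawOfList (listE litE)).comp (fst _ _)).pair ((snd _ _).pair (const _ ([] : List (ℕ × Bool)))))).congr fun _ => rfl
  exact ((rawOfList litE).comp h).congr fun _ => rfl

/-- The literal `ψ[s][j]` (`(0, false)` out of range), `s, j` binary. [cite: AroraBarak2009, §1.3] -/
theorem literalFP : CodeFP (pairE cnfE (pairE natE natE)) litE (fun p => (p.1.getD p.2.1 []).getD p.2.2 (0, false)) :=
  ((rawGetOr litE).comp ((clauseFP.comp ((fst _ _).pair (snd _ _).fst')).pair ((snd _ _).snd'.pair (const _ ((0 : ℕ), false))))).congr fun _ => rfl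

/-- **`varOfN ψ s j`** on codes. [cite: AroraBarak2009, §1.3] -/
theorem varOfNFP : CodeFP (pairE cnfE (pairE natE natE)) natE (fun p => varOfN p.1 p.2.1 p.2.2) := by
  have hlen : CodeFP (pairE cnfE (pairE natE natE)) natE (fun p => (p.1.getD p.2.1 []).length) :=
    ((natLength litE).comp (clauseFP.comp ((fst _ _).pair (snd _ _).fst'))).congr fun _ => rfl
  have hnv : CodeFP (pairE cnfE (pairE natE natE)) natE (fun p => p.1.numVars) := (numVarsFP.comp (fst _ _)).congr fun _ => rfl
  have htest : CodeFP (pairE cnfE (pairE natE natE)) bitE (fun p => decide (p.2.2 < (p.1.getD p.2.1 []).length)) :=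
    (natLt.comp ((snd _ _).snd'.pair hlen)).congr fun _ => rfl
  have hmin : CodeFP (pairE cnfE (pairE natE natE)) natE (fun p => min ((p.1.getD p.2.1 []).getD p.2.2 (0, false)).1 p.1.numVars) :=
    (natMin.comp (literalFP.fst'.pair hnv)).congr fun _ => rfl
  exact (htest.ite hmin hnv).congr fun p => by unfold varOfN; simp only [decide_eq_true_eq]

/-- **`endpointN ψ v`** on codes. [cite: AroraBarak2009, §1.3] -/
theorem endpointNFP : CodeFP (pairE cnfE natE) natE (fun p => endpointN p.1 p.2) := by
  have hv : CodeFP (pairE cnfE natE) natE (fun p => p.2) := snd _ _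
  have hmod2 : CodeFP (pairE cnfE natE) natE (fun p => p.2 % 2) := (natMod.comp (hv.pair (const _ 2))).congr fun _ => rfl
  have hs : CodeFP (pairE cnfE natE) natE (fun p => p.2 / 2 / 3) := (natDiv.comp ((natDiv.comp (hv.pair (const _ 2))).pair (const _ 3))).congr fun _ => rfl
  have hj : CodeFP (pairE cnfE natE) natE (fun p => p.2 / 2 % 3) := (natMod.comp ((natDiv.comp (hv.pair (const _ 2))).pair (const _ 3))).congr fun _ => rfl
  have htest : CodeFP (pairE cnfE natE) bitE (fun p => decide (p.2 % 2 = 0)) := (natEq.comp (hmod2.pair (const _ 0))).congr fun _ => rfl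
  have hy : CodeFP (pairE cnfE natE) natE (fun p => nV p.1 + p.2 / 2 / 3) :=
    (natAdd.comp ((natAdd.comp ((numVarsFP.comp (fst _ _)).pair (const _ 1))).pair hs)).congr fun _ => rfl
  have hvar : CodeFP (pairE cnfE natE) natE (fun p => varOfN p.1 (p.2 / 2 / 3) (p.2 / 2 % 3)) := (varOfNFP.comp ((fst _ _).pair (hs.pair hj))).congr fun _ => rfl
  exact (htest.ite hy hvar).congr fun p => by unfold endpointN; simp only [decide_eq_true_eq]

/-! ### Sizes -/

/-- `N ψ = 6 m` (binary). [folklore] -/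
theorem NFP : CodeFP cnfE natE (fun ψ => N ψ) :=
  (natMul.comp ((natMul.comp (lengthFP.pair (const _ 3))).pair (const _ 2))).congr fun ψ => by
    show ψ.length * 3 * 2 = N ψ; rw [show N ψ = m₁ ψ * 2 from rfl, m₁_eq]

/-- `N ψ = 6 m` (unary). [folklore] -/
theorem uNFP : CodeFP cnfE unE (fun ψ => N ψ) :=
  (unMul.comp ((unMul.comp (ulengthFP.pair (const _ 3))).pair (const _ 2))).congr fun ψ => by
    show ψ.length * 3 * 2 = N ψ; rw [show N ψ = m₁ ψ * 2 from rfl, m₁_eq]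

/-- `osD (m₁ ψ) = N + (N + 1)` (binary). [folklore] -/
theorem osdFP : CodeFP cnfE natE (fun ψ => osD (m₁ ψ)) :=
  (natAdd.comp (NFP.pair (natAdd.comp (NFP.pair (const _ 1))))).congr fun ψ => by unfold osD; rw [one_mul]

/-- `osD (m₁ ψ)` (unary). [folklore] -/
theorem uosdFP : CodeFP cnfE unE (fun ψ => osD (m₁ ψ)) :=
  (unAdd.comp (uNFP.pair (unSucc.comp uNFP))).congr fun ψ => by unfold osD; rw [one_mul]

/-- `D ψ` (binary). [folklore] -/
theorem DFP : CodeFP cnfE natE (fun ψ => D ψ) :=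
  (natAdd.comp ((natMul.comp (osdFP.pair NFP)).pair (natMul.comp (NFP.pair osdFP)))).congr fun _ => rfl

/-- `D ψ` (unary). [folklore] -/
theorem uDFP : CodeFP cnfE unE (fun ψ => D ψ) :=
  (unAdd.comp ((unMul.comp (uosdFP.pair uNFP)).pair (unMul.comp (uNFP.pair uosdFP)))).congr fun _ => rfl

/-! ### Clouds, positions, the expander step, neighbours -/

/-- **`cloudN ψ u`** on codes. [cite: AroraBarak2009, §1.3] -/
theorem cloudNFP : CodeFP (pairE cnfE natE) (rawE natE) (fun p => cloudN p.1 p.2) := by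
  have htest : CodeFP (pairE (pairE cnfE natE) natE) bitE (fun t => decide (endpointN t.1.1 t.2 = t.1.2)) :=
    (natEq.comp ((endpointNFP.comp ((fst _ _).fst'.pair (snd _ _))).pair (fst _ _).snd')).congr fun _ => rfl
  have hrange : CodeFP (pairE cnfE natE) (rawE natE) (fun p => List.range (N p.1)) := (urange.comp (uNFP.comp (fst _ _))).congr fun _ => rfl
  exact ((rawFilter (σ := CNF ℕ × ℕ) (α := ℕ) (p := fun t => decide (endpointN t.1.1 t.2 = t.1.2)) htest).comp
    ((CodeFP.id _).pair hrange)).congr fun p => rfl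

/-- **`posN ψ v`** on codes. [cite: AroraBarak2009, §1.3] -/
theorem posNFP : CodeFP (pairE cnfE natE) natE (fun p => posN p.1 p.2) :=
  (idxOfNat.comp ((snd _ _).pair (cloudNFP.comp ((fst _ _).pair endpointNFP)))).congr fun _ => rfl

/-- `ccStep k K p j` on codes. [folklore] -/
theorem ccStepFP : CodeFP (pairE (pairE natE natE) (pairE natE natE)) natE (fun t => ccStep t.1.1 t.1.2 t.2.1 t.2.2) := by
  have hk : CodeFP (pairE (pairE natE natE) (pairE natE natE)) natE (fun t => t.1.1) := (fst _ _).fst'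
  have hK : CodeFP (pairE (pairE natE natE) (pairE natE natE)) natE (fun t => t.1.2) := (fst _ _).snd'
  have hp : CodeFP (pairE (pairE natE natE) (pairE natE natE)) natE (fun t => t.2.1) := (snd _ _).fst'
  have hj : CodeFP (pairE (pairE natE natE) (pairE natE natE)) natE (fun t => t.2.2) := (snd _ _).snd'
  have hblk : CodeFP (pairE (pairE natE natE) (pairE natE natE)) natE (fun t => t.1.2 / t.1.1 * t.1.1) :=
    (natMul.comp ((natDiv.comp (hK.pair hk)).pair hk)).congr fun _ => rfl
  have htest : CodeFP (pairE (pairE natE natE) (pairE natE natE)) bitE (fun t => decide (t.2.2 < t.1.2 / t.1.1 * t.1.1)) :=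
    (natLt.comp (hj.pair hblk)).congr fun _ => rfl
  have hmove : CodeFP (pairE (pairE natE natE) (pairE natE natE)) natE (fun t => (t.2.1 + t.2.2 % t.1.1) % t.1.1) :=
    (natMod.comp ((natAdd.comp (hp.pair (natMod.comp (hj.pair hk)))).pair hk)).congr fun _ => rfl
  exact (htest.ite hmove hp).congr fun t => by unfold ccStep; simp only [decide_eq_true_eq]

/-- **`xStepN ψ v j`** on codes. [cite: AroraBarak2009, §1.3] -/
theorem xStepNFP : CodeFP (pairE cnfE (pairE natE natE)) natE (fun t => xStepN t.1 t.2.1 t.2.2) := by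
  have hψv : CodeFP (pairE cnfE (pairE natE natE)) (pairE cnfE natE) (fun t => (t.1, t.2.1)) := ((fst _ _).pair (snd _ _).fst').congr fun _ => rfl
  have hcl : CodeFP (pairE cnfE (pairE natE natE)) (rawE natE) (fun t => cloudN t.1 (endpointN t.1 t.2.1)) :=
    (cloudNFP.comp ((fst _ _).pair (endpointNFP.comp hψv))).congr fun _ => rfl
  have hpos : CodeFP (pairE cnfE (pairE natE natE)) natE (fun t => posN t.1 t.2.1) := (posNFP.comp hψv).congr fun _ => rfl
  have hstep : CodeFP (pairE cnfE (pairE natE natE)) natE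
      (fun t => ccStep (cloudN t.1 (endpointN t.1 t.2.1)).length (N t.1) (posN t.1 t.2.1) t.2.2) :=
    (ccStepFP.comp ((((natLength natE).comp hcl).pair (NFP.comp (fst _ _))).pair (hpos.pair (snd _ _).snd'))).congr fun _ => rfl
  exact ((rawGetOr natE).comp (hcl.pair (hstep.pair (snd _ _).fst'))).congr fun t => rfl

/-- `partnerN v` on codes. [folklore] -/
theorem partnerNFP : CodeFP natE natE partnerN := by
  have htest : CodeFP natE bitE (fun v => decide (v % 2 = 0)) := (natEq.comp ((natMod.comp ((CodeFP.id _).pair (const _ 2))).pair (const _ 0))).congr fun _ => rfl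
  exact (htest.ite (natAdd.comp ((CodeFP.id _).pair (const _ 1))) (natSub.comp ((CodeFP.id _).pair (const _ 1)))).congr fun v => by
    unfold partnerN; simp only [decide_eq_true_eq, id_eq]

/-- **`osNbrN ψ v i₀`** on codes. [cite: AroraBarak2009, §1.3] -/
theorem osNbrNFP : CodeFP (pairE cnfE (pairE natE natE)) natE (fun t => osNbrN t.1 t.2.1 t.2.2) := by
  have hv : CodeFP (pairE cnfE (pairE natE natE)) natE (fun t => t.2.1) := (snd _ _).fst'
  have hi : CodeFP (pairE cnfE (pairE natE natE)) natE (fun t => t.2.2) := (snd _ _).snd'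
  have hN : CodeFP (pairE cnfE (pairE natE natE)) natE (fun t => N t.1) := (NFP.comp (fst _ _)).congr fun _ => rfl
  have hpart : CodeFP (pairE cnfE (pairE natE natE)) natE (fun t => partnerN t.2.1) := (partnerNFP.comp hv).congr fun _ => rfl
  have ht1 : CodeFP (pairE cnfE (pairE natE natE)) bitE (fun t => decide (t.2.2 < N t.1)) := (natLt.comp (hi.pair hN)).congr fun _ => rfl
  have hdiff : CodeFP (pairE cnfE (pairE natE natE)) natE (fun t => t.2.2 - N t.1) := (natSub.comp (hi.pair hN)).congr fun _ => rfl
  have ht2 : CodeFP (pairE cnfE (pairE natE natE)) bitE (fun t => decide (t.2.2 - N t.1 = 0)) := (natEq.comp (hdiff.pair (const _ 0))).congr fun _ => rfl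
  have hx : CodeFP (pairE cnfE (pairE natE natE)) natE (fun t => xStepN t.1 t.2.1 (t.2.2 - N t.1 - 1)) :=
    (xStepNFP.comp ((fst _ _).pair (hv.pair (natSub.comp (hdiff.pair (const _ 1)))))).congr fun _ => rfl
  exact (ht1.ite hpart (ht2.ite hpart hx)).congr fun t => by unfold osNbrN; simp only [decide_eq_true_eq]

/-- **`nbrN ψ v i`** on codes. [cite: AroraBarak2009, §1.3] -/
theorem nbrNFP : CodeFP (pairE cnfE (pairE natE natE)) natE (fun t => nbrN t.1 t.2.1 t.2.2) := by
  have hv : CodeFP (pairE cnfE (pairE natE natE)) natE (fun t => t.2.1) := (snd _ _).fst'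
  have hi : CodeFP (pairE cnfE (pairE natE natE)) natE (fun t => t.2.2) := (snd _ _).snd'
  have hN : CodeFP (pairE cnfE (pairE natE natE)) natE (fun t => N t.1) := (NFP.comp (fst _ _)).congr fun _ => rfl
  have hosd : CodeFP (pairE cnfE (pairE natE natE)) natE (fun t => osD (m₁ t.1)) := (osdFP.comp (fst _ _)).congr fun _ => rfl
  have hbound : CodeFP (pairE cnfE (pairE natE natE)) natE (fun t => osD (m₁ t.1) * N t.1) := (natMul.comp (hosd.pair hN)).congr fun _ => rfl
  have htest : CodeFP (pairE cnfE (pairE natE natE)) bitE (fun t => decide (t.2.2 < osD (m₁ t.1) * N t.1)) := (natLt.comp (hi.pair hbound)).congr fun _ => rfl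
  have hos : CodeFP (pairE cnfE (pairE natE natE)) natE (fun t => osNbrN t.1 t.2.1 (t.2.2 / N t.1)) :=
    (osNbrNFP.comp ((fst _ _).pair (hv.pair (natDiv.comp (hi.pair hN))))).congr fun _ => rfl
  have hcc : CodeFP (pairE cnfE (pairE natE natE)) natE (fun t => (t.2.1 + (t.2.2 - osD (m₁ t.1) * N t.1) / osD (m₁ t.1)) % N t.1) :=
    (natMod.comp ((natAdd.comp (hv.pair (natDiv.comp ((natSub.comp (hi.pair hbound)).pair hosd)))).pair hN)).congr fun _ => rfl
  exact (htest.ite hos hcc).congr fun t => by unfold nbrN; simp only [decide_eq_true_eq]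

/-! ### Descriptors and acceptance data -/

/-- Codes of `Fin k` values: the binary numeral. [folklore] -/
def finE (k : ℕ) : Fin k → List Bool := fun x => natE x.val

/-- `finE` is injective. [folklore] -/
theorem finE_injective (k : ℕ) : Function.Injective (finE k) := fun _ _ h => Fin.ext (natE_injective h)

/-- The code of polarity triples. [folklore] -/
abbrev polsE : Bool × Bool × Bool → List Bool := pairE bitE (pairE bitE bitE)

/-- The code of descriptors. [folklore] -/
abbrev descE : Desc → List Bool := pairE (finE 4) (pairE (finE 4) (pairE polsE (finE 3)))

/-- `descE` is injective. [folklore] -/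
theorem descE_injective : Function.Injective descE :=
  pairE_injective (finE_injective 4) (pairE_injective (finE_injective 4)
    (pairE_injective (pairE_injective bitE_injective (pairE_injective bitE_injective bitE_injective)) (finE_injective 3)))

/-- The kind as a number. [folklore] -/
def kindNat (ψ : CNF ℕ) (b i : ℕ) : ℕ :=
  if i < osD (m₁ ψ) * N ψ then
    (if i / N ψ < N ψ then (if b = 0 then 0 else 1) else if i / N ψ - N ψ = 0 then (if b = 0 then 0 else 1) else 2)
  else 3

/-- `kindNat` is the value of `kindN`. [folklore] -/
theorem kindN_val (ψ : CNF ℕ) (b i : ℕ) : (kindN ψ b i).val = kindNat ψ b i := by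
  unfold kindN kindNat
  split_ifs <;> rfl

/-- `kindNat` on codes. [folklore] -/
theorem kindNatFP : CodeFP (pairE cnfE (pairE natE natE)) natE (fun t => kindNat t.1 t.2.1 t.2.2) := by
  have hb : CodeFP (pairE cnfE (pairE natE natE)) natE (fun t => t.2.1) := (snd _ _).fst'
  have hi : CodeFP (pairE cnfE (pairE natE natE)) natE (fun t => t.2.2) := (snd _ _).snd'
  have hN : CodeFP (pairE cnfE (pairE natE natE)) natE (fun t => N t.1) := (NFP.comp (fst _ _)).congr fun _ => rfl
  have hosd : CodeFP (pairE cnfE (pairE natE natE)) natE (fun t => osD (m₁ t.1)) := (osdFP.comp (fst _ _)).congr fun _ => rfl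
  have ht0 : CodeFP (pairE cnfE (pairE natE natE)) bitE (fun t => decide (t.2.2 < osD (m₁ t.1) * N t.1)) :=
    (natLt.comp (hi.pair (natMul.comp (hosd.pair hN)))).congr fun _ => rfl
  have hq : CodeFP (pairE cnfE (pairE natE natE)) natE (fun t => t.2.2 / N t.1) := (natDiv.comp (hi.pair hN)).congr fun _ => rfl
  have ht1 : CodeFP (pairE cnfE (pairE natE natE)) bitE (fun t => decide (t.2.2 / N t.1 < N t.1)) := (natLt.comp (hq.pair hN)).congr fun _ => rfl
  have ht2 : CodeFP (pairE cnfE (pairE natE natE)) bitE (fun t => decide (t.2.2 / N t.1 - N t.1 = 0)) :=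
    (natEq.comp ((natSub.comp (hq.pair hN)).pair (const _ 0))).congr fun _ => rfl
  have htb : CodeFP (pairE cnfE (pairE natE natE)) bitE (fun t => decide (t.2.1 = 0)) := (natEq.comp (hb.pair (const _ 0))).congr fun _ => rfl
  have hfb : CodeFP (pairE cnfE (pairE natE natE)) natE (fun t => if decide (t.2.1 = 0) then 0 else 1) :=
    htb.ite (const _ 0) (const _ 1)
  exact (ht0.ite (ht1.ite hfb (ht2.ite hfb (const _ 2))) (const _ 3)).congr fun t => by
    unfold kindNat; simp only [decide_eq_true_eq]

/-- **`descN ψ v i`** on codes. [cite: AroraBarak2009, §1.3] -/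
theorem descNFP : CodeFP (pairE cnfE (pairE natE natE)) descE (fun t => descN t.1 t.2.1 t.2.2) := by
  have hv : CodeFP (pairE cnfE (pairE natE natE)) natE (fun t => t.2.1) := (snd _ _).fst'
  have hi : CodeFP (pairE cnfE (pairE natE natE)) natE (fun t => t.2.2) := (snd _ _).snd'
  have hs : CodeFP (pairE cnfE (pairE natE natE)) natE (fun t => t.2.1 / 2 / 3) :=
    (natDiv.comp ((natDiv.comp (hv.pair (const _ 2))).pair (const _ 3))).congr fun _ => rfl
  -- kind
  have hkind : CodeFP (pairE cnfE (pairE natE natE)) (finE 4) (fun t => kindN t.1 (t.2.1 % 2) t.2.2) :=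
    (kindNatFP.comp ((fst _ _).pair ((natMod.comp (hv.pair (const _ 2))).pair hi))).recodeOut fun t => by
      show natE _ = natE _; rw [kindN_val]
  -- clipped length
  have hlen : CodeFP (pairE cnfE (pairE natE natE)) (finE 4) (fun t => lenN t.1 (t.2.1 / 2 / 3)) :=
    (natMin.comp (((natLength litE).comp (clauseFP.comp ((fst _ _).pair hs))).pair (const _ 3))).recodeOut fun t => rfl
  -- polarities
  have hpol : ∀ j : ℕ, CodeFP (pairE cnfE (pairE natE natE)) bitE (fun t => ((t.1.getD (t.2.1 / 2 / 3) []).getD j (0, false)).2) := fun j =>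
    (literalFP.comp ((fst _ _).pair (hs.pair (const _ j)))).snd'.congr fun _ => rfl
  have hpols : CodeFP (pairE cnfE (pairE natE natE)) polsE (fun t => polsN t.1 (t.2.1 / 2 / 3)) :=
    ((hpol 0).pair ((hpol 1).pair (hpol 2))).congr fun _ => rfl
  -- position
  have hpos : CodeFP (pairE cnfE (pairE natE natE)) (finE 3) (fun t => (⟨t.2.1 / 2 % 3, Nat.mod_lt _ (by norm_num)⟩ : Fin 3)) :=
    (natMod.comp ((natDiv.comp (hv.pair (const _ 2))).pair (const _ 3))).recodeOut fun _ => rfl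
  exact (hkind.pair (hlen.pair (hpols.pair hpos))).congr fun _ => rfl

/-- **The acceptance data `accOfDesc (descN ψ v i)`** on codes (the finite table of `accOfDesc`). [cite: AroraBarak2009, §1.3] -/
theorem accFP : CodeFP (pairE cnfE (pairE natE natE)) (rawE (pairE natE natE)) (fun t => accOfDesc (descN t.1 t.2.1 t.2.2)) :=
  ((ofFintype descE_injective (rawE (pairE natE natE)) accOfDesc).comp descNFP).congr fun _ => rfl

end E3LC

end Expander

end Literature.Computability.Complexity


/-!
# The one-shot reduction from gap-E3SAT to gap label cover is polynomial time

Topic `Computability/Complexity`, namespace `Literature.Computability.Complexity.Expander.E3LC`.  The machine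
level of `GapE3CNFToLabelCover.lean`: a typed polynomial-time program (`CodeFP.lean`) computing, on
`encodingCNF` codes, the `LabelCoverInstance.encoding` code of `e3Inst ε₁ ε' ψ` — the constraint table of the
dart instance (`DartTables.dartTable`, through `E3GraphFP.nbrNFP` / `accFP`), the `k`-fold product tables
(`LabelCoverListOps.prodL`), the Alice-side blow-up, the rendering with shifted indices, the exact-width-`3`
/ non-emptiness / accepting-pairs tests, and the two fixed instances — assembled with the typed combinators;
the semantic bridge is `dartLC_eq_dartLCList` with `nbrN_eq` and `accNat_eq_accOfDesc`.

* `dartTableFP`, `prodLFP`, `blowALFP`, `dartNpowLFP`, `dartLCListTupleFP`, `exactB`/`exactBFP`,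
  `haccBFP`, `e3InstB`, `e3Inst_eq_e3InstB`;
* **`e3Inst_codeFP`**: `∃ f ∈ FP, ∀ ψ, f (encodingCNF.encode ψ) = LabelCoverInstance.encoding.encode (e3Inst ε₁ ε' ψ)`;
* **`isNPHard_gapLabelCover_forall_of_gapE3SAT_hard`**: NP-hardness of `gapE3SAT (1/8 - ε₁)` (`0 < ε₁ ≤ 1/8`)
  alone now gives `∀ ε > 0, ∃ W, (gapLabelCover W ε).IsNPHard` (Arora–Barak Thm. 22.15 in the tree's form).

## References

* S. Arora, B. Barak, *Computational Complexity: A Modern Approach*, CUP 2009, §1.3, Thm. 22.15.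
-/

noncomputable section

namespace Literature.Computability.Complexity

open _root_.Computability

namespace Expander

namespace E3LC

open CodeFP RotGraph DegreeReduction

/-! ### Encoders of rows and tuples -/

/-- A row of a constraint table: `(src, dst, raw projection row)`. [folklore] -/
abbrev rowE : ℕ × ℕ × List ℕ → List Bool := pairE natE (pairE natE (rawE natE))

/-- A rendered constraint: `(fst, snd, projection list)` in the tree's format. [folklore] -/
abbrev conE : ℕ × ℕ × List ℕ → List Bool := pairE natE (pairE natE (listE natE))

/-- The tuple code of a label cover instance. [folklore] -/
abbrev tupE : ℕ × ℕ × List (ℕ × ℕ × List ℕ) → List Bool := pairE natE (pairE natE (listE conE))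

/-- `tupE` is `LabelCoverInstance.tupleEncoding.encode`. [folklore] -/
theorem tupE_eq : (LabelCoverInstance.tupleEncoding.encode : ℕ × ℕ × List (ℕ × ℕ × List ℕ) → List Bool) = tupE := by
  unfold LabelCoverInstance.tupleEncoding
  rw [pairE_eq, pairE_eq, listE_eq, pairE_eq, pairE_eq, listE_eq, natE_eq]

/-- The acceptance data of `ψ`. [folklore] -/
def accN (ψ : CNF ℕ) (v i : ℕ) : List (ℕ × ℕ) := accOfDesc (descN ψ v i)

/-! ### The dart table -/

/-- `aliasN acc u` on codes. [folklore] -/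
theorem aliasNFP : CodeFP (pairE (rawE (pairE natE natE)) natE) (pairE natE natE) (fun p => aliasN p.1 p.2) := by
  have hlen : CodeFP (pairE (rawE (pairE natE natE)) natE) natE (fun p => p.1.length) := ((natLength _).comp (fst _ _)).congr fun _ => rfl
  have htest : CodeFP (pairE (rawE (pairE natE natE)) natE) bitE (fun p => decide (0 < p.1.length)) := (natLt.comp ((const _ 0).pair hlen)).congr fun _ => rfl
  have hget : CodeFP (pairE (rawE (pairE natE natE)) natE) (pairE natE natE) (fun p => p.1.getD (p.2 % p.1.length) (0, 0)) :=
    ((rawGetOr (pairE natE natE)).comp ((fst _ _).pair ((natMod.comp ((snd _ _).pair hlen)).pair (const _ ((0 : ℕ), (0 : ℕ)))))).congr fun _ => rfl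
  exact (htest.ite hget (const _ ((0 : ℕ), (0 : ℕ)))).congr fun p => by unfold aliasN; simp only [decide_eq_true_eq]

/-- A projection row `[(aliasN acc u).s | u < 64]`. [folklore] -/
theorem projRowFP (s : Bool) : CodeFP (rawE (pairE natE natE)) (rawE natE)
    (fun acc => (List.range (8 * 8)).map fun u => if s then (aliasN acc u).2 else (aliasN acc u).1) := by
  have hitem : CodeFP (pairE (rawE (pairE natE natE)) natE) natE (fun p => if s then (aliasN p.1 p.2).2 else (aliasN p.1 p.2).1) := by
    cases s
    · exact aliasNFP.fst'.congr fun _ => rfl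
    · exact aliasNFP.snd'.congr fun _ => rfl
  exact ((map (σ := List (ℕ × ℕ)) (α := ℕ) (g := fun p => if s then (aliasN p.1 p.2).2 else (aliasN p.1 p.2).1) hitem).comp
    ((CodeFP.id _).pair (const _ (List.range (8 * 8))))).congr fun _ => rfl

/-- `dartRows 8 δ v nb acc` on codes. [folklore] -/
theorem dartRowsFP : CodeFP (pairE natE (pairE natE (pairE natE (rawE (pairE natE natE))))) (rawE rowE)
    (fun t => dartRows 8 t.1 t.2.1 t.2.2.1 t.2.2.2) := by
  have hδ : CodeFP (pairE natE (pairE natE (pairE natE (rawE (pairE natE natE))))) natE (fun t => t.1) := fst _ _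
  have hv : CodeFP (pairE natE (pairE natE (pairE natE (rawE (pairE natE natE))))) natE (fun t => t.2.1) := (snd _ _).fst'
  have hnb : CodeFP (pairE natE (pairE natE (pairE natE (rawE (pairE natE natE))))) natE (fun t => t.2.2.1) := ((snd _ _).snd').fst'
  have hacc : CodeFP (pairE natE (pairE natE (pairE natE (rawE (pairE natE natE))))) (rawE (pairE natE natE)) (fun t => t.2.2.2) := ((snd _ _).snd').snd'
  have hr0 : CodeFP (pairE natE (pairE natE (pairE natE (rawE (pairE natE natE))))) rowE
      (fun t => (t.1, t.2.1, (List.range (8 * 8)).map fun u => (aliasN t.2.2.2 u).1)) :=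
    (hδ.pair (hv.pair ((projRowFP false).comp hacc))).congr fun _ => rfl
  have hr1 : CodeFP (pairE natE (pairE natE (pairE natE (rawE (pairE natE natE))))) rowE
      (fun t => (t.1, t.2.2.1, (List.range (8 * 8)).map fun u => (aliasN t.2.2.2 u).2)) :=
    (hδ.pair (hnb.pair ((projRowFP true).comp hacc))).congr fun _ => rfl
  exact ((rawCons rowE).comp (hr0.pair ((rawCons rowE).comp (hr1.pair (const _ ([] : List (ℕ × ℕ × List ℕ))))))).congr fun _ => rfl

/-- **The dart table of `ψ`** on codes. [cite: AroraBarak2009, §1.3] -/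
theorem dartTableFP : CodeFP cnfE (rawE rowE) (fun ψ => dartTable 8 (N ψ) (D ψ) (nbrN ψ) (accN ψ)) := by
  -- item of the inner loop: context `(ψ, v)`, item `i`
  have hψ : CodeFP (pairE (pairE cnfE natE) natE) cnfE (fun t => t.1.1) := (fst _ _).fst'
  have hv : CodeFP (pairE (pairE cnfE natE) natE) natE (fun t => t.1.2) := (fst _ _).snd'
  have hi : CodeFP (pairE (pairE cnfE natE) natE) natE (fun t => t.2) := snd _ _
  have hvi : CodeFP (pairE (pairE cnfE natE) natE) (pairE cnfE (pairE natE natE)) (fun t => (t.1.1, t.1.2, t.2)) := (hψ.pair (hv.pair hi)).congr fun _ => rfl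
  have hδ : CodeFP (pairE (pairE cnfE natE) natE) natE (fun t => t.2 + D t.1.1 * t.1.2) :=
    (natAdd.comp (hi.pair (natMul.comp ((DFP.comp hψ).pair hv)))).congr fun _ => rfl
  have hitem : CodeFP (pairE (pairE cnfE natE) natE) (rawE rowE)
      (fun t => dartRows 8 (t.2 + D t.1.1 * t.1.2) t.1.2 (nbrN t.1.1 t.1.2 t.2) (accN t.1.1 t.1.2 t.2)) :=
    (dartRowsFP.comp (hδ.pair (hv.pair ((nbrNFP.comp hvi).pair (accFP.comp hvi))))).congr fun _ => rfl
  have hinner : CodeFP (pairE cnfE natE) (rawE rowE)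
      (fun q => ((List.range (D q.1)).map fun i => dartRows 8 (i + D q.1 * q.2) q.2 (nbrN q.1 q.2 i) (accN q.1 q.2 i)).flatten) :=
    ((flatten rowE).comp ((map (σ := CNF ℕ × ℕ) (α := ℕ) (g := fun t => dartRows 8 (t.2 + D t.1.1 * t.1.2) t.1.2 (nbrN t.1.1 t.1.2 t.2) (accN t.1.1 t.1.2 t.2)) hitem).comp
      ((CodeFP.id _).pair (urange.comp (uDFP.comp (fst _ _)))))).congr fun _ => rfl
  exact ((flatten rowE).comp ((map (σ := CNF ℕ) (α := ℕ) (g := fun q => ((List.range (D q.1)).map fun i =>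
      dartRows 8 (i + D q.1 * q.2) q.2 (nbrN q.1 q.2 i) (accN q.1 q.2 i)).flatten) hinner).comp
      ((CodeFP.id _).pair (urange.comp uNFP)))).congr fun ψ => rfl

/-! ### Products, blow-up, powers -/

/-- **`prodL`** on codes: context `(nB₂, nA₂, WA₂)`, the two tables. [cite: AroraBarak2009, §1.3] -/
theorem prodLFP : CodeFP (pairE (pairE natE (pairE natE natE)) (pairE (rawE rowE) (rawE rowE))) (rawE rowE)
    (fun t => BLC.prodL t.1.1 t.1.2.1 t.1.2.2 t.2.1 t.2.2) := by
  -- the product projection row: context `(WA₂, p₂)`, item `a₁`; inner context `(WA₂, a₁)`, item `a₂`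
  have hin : CodeFP (pairE (pairE natE natE) natE) natE (fun t => t.2 + t.1.1 * t.1.2) :=
    (natAdd.comp ((snd _ _).pair (natMul.comp ((fst _ _).fst'.pair (fst _ _).snd')))).congr fun _ => rfl
  have hrow1 : CodeFP (pairE (pairE natE (rawE natE)) natE) (rawE natE) (fun t => t.1.2.map fun a₂ => a₂ + t.1.1 * t.2) :=
    ((map (σ := ℕ × ℕ) (α := ℕ) (g := fun t => t.2 + t.1.1 * t.1.2) hin).comp (((fst _ _).fst'.pair (snd _ _)).pair (fst _ _).snd')).congr fun _ => rfl
  have hproj : CodeFP (pairE natE (pairE (rawE natE) (rawE natE))) (rawE natE)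
      (fun t => (t.2.1.map fun a₁ => t.2.2.map fun a₂ => a₂ + t.1 * a₁).flatten) :=
    ((flatten natE).comp ((map (σ := ℕ × List ℕ) (α := ℕ) (g := fun t => t.1.2.map fun a₂ => a₂ + t.1.1 * t.2) hrow1).comp
      (((fst _ _).pair (snd _ _).snd').pair (snd _ _).fst'))).congr fun _ => rfl
  -- the product row: context `(sizes, t₁)`, item `t₂`
  have hS : CodeFP (pairE (pairE (pairE natE (pairE natE natE)) rowE) rowE) (pairE natE (pairE natE natE)) (fun t => t.1.1) := (fst _ _).fst'
  have hT1 : CodeFP (pairE (pairE (pairE natE (pairE natE natE)) rowE) rowE) rowE (fun t => t.1.2) := (fst _ _).snd'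
  have hT2 : CodeFP (pairE (pairE (pairE natE (pairE natE natE)) rowE) rowE) rowE (fun t => t.2) := snd _ _
  have hrow : CodeFP (pairE (pairE (pairE natE (pairE natE natE)) rowE) rowE) rowE
      (fun t => (t.2.1 + t.1.1.1 * t.1.2.1, t.2.2.1 + t.1.1.2.1 * t.1.2.2.1, (t.1.2.2.2.map fun a₁ => t.2.2.2.map fun a₂ => a₂ + t.1.1.2.2 * a₁).flatten)) :=
    ((natAdd.comp (hT2.fst'.pair (natMul.comp (hS.fst'.pair hT1.fst')))).pair
      ((natAdd.comp (hT2.snd'.fst'.pair (natMul.comp (hS.snd'.fst'.pair hT1.snd'.fst')))).pair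
        (hproj.comp (hS.snd'.snd'.pair (hT1.snd'.snd'.pair hT2.snd'.snd'))))).congr fun _ => rfl
  have houter : CodeFP (pairE (pairE (pairE natE (pairE natE natE)) (rawE rowE)) rowE) (rawE rowE)
      (fun q => q.1.2.map fun t₂ => (t₂.1 + q.1.1.1 * q.2.1, t₂.2.1 + q.1.1.2.1 * q.2.2.1, (q.2.2.2.map fun a₁ => t₂.2.2.map fun a₂ => a₂ + q.1.1.2.2 * a₁).flatten)) :=
    ((map (σ := (ℕ × ℕ × ℕ) × (ℕ × ℕ × List ℕ)) (α := ℕ × ℕ × List ℕ)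
      (g := fun t => (t.2.1 + t.1.1.1 * t.1.2.1, t.2.2.1 + t.1.1.2.1 * t.1.2.2.1, (t.1.2.2.2.map fun a₁ => t.2.2.2.map fun a₂ => a₂ + t.1.1.2.2 * a₁).flatten)) hrow).comp
      (((fst _ _).fst'.pair (snd _ _)).pair (fst _ _).snd')).congr fun _ => rfl
  exact ((flatten rowE).comp ((map (σ := (ℕ × ℕ × ℕ) × List (ℕ × ℕ × List ℕ)) (α := ℕ × ℕ × List ℕ)
      (g := fun q => q.1.2.map fun t₂ => (t₂.1 + q.1.1.1 * q.2.1, t₂.2.1 + q.1.1.2.1 * q.2.2.1, (q.2.2.2.map fun a₁ => t₂.2.2.map fun a₂ => a₂ + q.1.1.2.2 * a₁).flatten)) houter).comp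
      (((fst _ _).pair (snd _ _).snd').pair (snd _ _).fst'))).congr fun t => rfl

/-- **`blowAL`** on codes: the factor `c` in unary, the table. [cite: AroraBarak2009, §1.3] -/
theorem blowALFP : CodeFP (pairE unE (rawE rowE)) (rawE rowE) (fun t => BLC.blowAL t.1 t.2) := by
  -- context `(c, t)` (c binary), item `j`
  have hrow : CodeFP (pairE (pairE natE rowE) natE) rowE (fun q => (q.1.2.1, q.2 + q.1.1 * q.1.2.2.1, q.1.2.2.2)) :=
    (((fst _ _).snd'.fst').pair ((natAdd.comp ((snd _ _).pair (natMul.comp ((fst _ _).fst'.pair (fst _ _).snd'.snd'.fst')))).pair (fst _ _).snd'.snd'.snd')).congr fun _ => rfl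
  have hone : CodeFP (pairE (pairE unE natE) rowE) (rawE rowE) (fun q => (List.range q.1.1).map fun j => (q.2.1, j + q.1.2 * q.2.2.1, q.2.2.2)) :=
    ((map (σ := ℕ × (ℕ × ℕ × List ℕ)) (α := ℕ) (g := fun q => (q.1.2.1, q.2 + q.1.1 * q.1.2.2.1, q.1.2.2.2)) hrow).comp
      ((((fst _ _).snd').pair (snd _ _)).pair (urange.comp (fst _ _).fst'))).congr fun _ => rfl
  have hall : CodeFP (pairE (pairE unE natE) (rawE rowE)) (rawE rowE) (fun q => (q.2.map fun t => (List.range q.1.1).map fun j => (t.1, j + q.1.2 * t.2.1, t.2.2)).flatten) :=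
    ((flatten rowE).comp (map (σ := ℕ × ℕ) (α := ℕ × ℕ × List ℕ) (g := fun q => (List.range q.1.1).map fun j => (q.2.1, j + q.1.2 * q.2.2.1, q.2.2.2)) hone)).congr fun _ => rfl
  exact (hall.comp (((fst _ _).pair (natOfUn.comp (fst _ _))).pair (snd _ _))).congr fun t => rfl

/-- `D ψ ^ k` (unary). [folklore] -/
theorem uDpowFP : ∀ k : ℕ, CodeFP cnfE unE (fun ψ => D ψ ^ k)
  | 0 => (const _ 1).congr fun _ => by rw [pow_zero]
  | k + 1 => (unMul.comp ((uDpowFP k).pair uDFP)).congr fun _ => by rw [pow_succ]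

/-- A binary power with a constant exponent. [folklore] -/
theorem natPowConst {g : CNF ℕ → ℕ} (hg : CodeFP cnfE natE g) (k : ℕ) : CodeFP cnfE natE (fun ψ => g ψ ^ k) :=
  (natPow.comp (hg.pair (const _ k))).congr fun _ => rfl

/-- **The tables of the powers `dartBLC^{⊗k}`** on codes. [cite: AroraBarak2009, §1.3 and §22.3.1] -/
theorem dartNpowLFP : ∀ k : ℕ, CodeFP cnfE (rawE rowE) (fun ψ => dartNpowL 8 (N ψ) (D ψ) (nbrN ψ) (accN ψ) k)
  | 0 => (const _ [((0 : ℕ), (0 : ℕ), [(0 : ℕ)])]).congr fun _ => rfl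
  | k + 1 => by
    have hsizes : CodeFP cnfE (pairE natE (pairE natE natE)) (fun ψ => ((N ψ * D ψ) ^ k, N ψ ^ k, 8 ^ k)) :=
      ((natPowConst ((natMul.comp (NFP.pair DFP)).congr fun _ => rfl) k).pair ((natPowConst NFP k).pair (const _ (8 ^ k)))).congr fun _ => rfl
    exact (prodLFP.comp (hsizes.pair (dartTableFP.pair (dartNpowLFP k)))).congr fun ψ => rfl

/-- The rendered constraints of `φ_k`: shift Alice's indices and head the projection lists. [folklore] -/
theorem renderFP (k : ℕ) : CodeFP cnfE (listE conE)
    (fun ψ => (BLC.blowAL (D ψ ^ k) (dartNpowL 8 (N ψ) (D ψ) (nbrN ψ) (accN ψ) k)).map fun t => (t.1, (N ψ * D ψ) ^ k + t.2.1, t.2.2)) := by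
  have hrows : CodeFP cnfE (rawE rowE) (fun ψ => BLC.blowAL (D ψ ^ k) (dartNpowL 8 (N ψ) (D ψ) (nbrN ψ) (accN ψ) k)) :=
    (blowALFP.comp ((uDpowFP k).pair (dartNpowLFP k))).congr fun _ => rfl
  have hnB : CodeFP cnfE natE (fun ψ => (N ψ * D ψ) ^ k) := natPowConst ((natMul.comp (NFP.pair DFP)).congr fun _ => rfl) k
  have hitem : CodeFP (pairE natE rowE) conE (fun q => (q.2.1, q.1 + q.2.2.1, q.2.2.2)) :=
    (((snd _ _).fst').pair ((natAdd.comp ((fst _ _).pair (snd _ _).snd'.fst')).pair ((listOfRaw natE).comp (snd _ _).snd'.snd'))).congr fun _ => rfl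
  exact ((listOfRaw conE).comp ((map (σ := ℕ) (α := ℕ × ℕ × List ℕ) (g := fun q => (q.2.1, q.1 + q.2.2.1, q.2.2.2)) hitem).comp (hnB.pair hrows))).congr fun _ => rfl

/-- **The tuple of `dartLCList`** on codes. [cite: AroraBarak2009, Thm. 22.15 (the instances)] -/
theorem dartLCListTupleFP (k : ℕ) : CodeFP cnfE tupE (fun ψ => (dartLCList 8 (N ψ) (D ψ) (nbrN ψ) (accN ψ) k).toTuple) := by
  have hnum : CodeFP cnfE natE (fun ψ => (N ψ * D ψ) ^ k + N ψ ^ k * D ψ ^ k) :=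
    (natAdd.comp ((natPowConst ((natMul.comp (NFP.pair DFP)).congr fun _ => rfl) k).pair (natMul.comp ((natPowConst NFP k).pair (natPowConst DFP k))))).congr fun _ => rfl
  exact (hnum.pair ((const _ ((8 * 8) ^ k)).pair (renderFP k))).congr fun ψ => by
    simp only [dartLCList, LabelCoverInstance.toTuple, shiftRows, List.map_map]
    rfl

/-! ### Tests and the dispatch -/

/-- The exact-width-`3` test. [folklore] -/
def exactB (ψ : CNF ℕ) : Bool := ψ.all fun c => decide (c.length = 3) && decide ((c.map Prod.fst).Nodup)

/-- `exactB` decides `IsExactWidth 3`. [folklore] -/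
theorem exactB_eq_true_iff (ψ : CNF ℕ) : exactB ψ = true ↔ ψ.IsExactWidth 3 := by
  unfold exactB CNF.IsExactWidth
  simp only [List.all_eq_true, Bool.and_eq_true, decide_eq_true_eq]

/-- `exactB` on codes. [folklore] -/
theorem exactBFP : CodeFP cnfE bitE exactB := by
  have hitem : CodeFP (pairE cnfE (rawE litE)) bitE (fun q => decide (q.2.length = 3) && decide ((q.2.map Prod.fst).Nodup)) :=
    ((natEq.comp (((natLength litE).comp (snd _ _)).pair (const _ 3))).and ((nodup natE_injective).comp ((map₀ (fst natE bitE)).comp (snd _ _)))).congr fun _ => rfl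
  exact ((all (σ := CNF ℕ) (α := List (ℕ × Bool)) (p := fun q => decide (q.2.length = 3) && decide ((q.2.map Prod.fst).Nodup)) hitem).comp
    ((CodeFP.id _).pair rawClausesFP)).congr fun _ => rfl

/-- The accepting-pairs test `haccB` on codes. [folklore] -/
theorem haccBFP : CodeFP cnfE bitE (fun ψ => haccB (N ψ) (D ψ) (accN ψ)) := by
  have hitem : CodeFP (pairE (pairE cnfE natE) natE) bitE (fun t => decide (0 < (accN t.1.1 t.1.2 t.2).length)) :=
    (natLt.comp ((const _ 0).pair ((natLength _).comp (accFP.comp ((fst _ _).fst'.pair ((fst _ _).snd'.pair (snd _ _))))))).congr fun _ => rfl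
  have hinner : CodeFP (pairE cnfE natE) bitE (fun q => (List.range (D q.1)).all fun i => decide (0 < (accN q.1 q.2 i).length)) :=
    ((all (σ := CNF ℕ × ℕ) (α := ℕ) (p := fun t => decide (0 < (accN t.1.1 t.1.2 t.2).length)) hitem).comp
      ((CodeFP.id _).pair (urange.comp (uDFP.comp (fst _ _))))).congr fun _ => rfl
  exact ((all (σ := CNF ℕ) (α := ℕ) (p := fun q => (List.range (D q.1)).all fun i => decide (0 < (accN q.1 q.2 i).length)) hinner).comp
    ((CodeFP.id _).pair (urange.comp uNFP))).congr fun ψ => rfl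

/-- **The instance map with Boolean tests and list-level instances.** [cite: AroraBarak2009, Thm. 22.15] -/
def e3InstB (ε₁ ε' : ℝ) (ψ : CNF ℕ) : LabelCoverInstance :=
  if exactB ψ then
    if decide (0 < ψ.length) then
      if haccB (N ψ) (D ψ) (accN ψ) then dartLCList 8 (N ψ) (D ψ) (nbrN ψ) (accN ψ) (kOf ε₁ ε') else constLC (Wk ε₁ ε') (Wk ε₁ ε')
    else constLC (Wk ε₁ ε') 1
  else constLC (Wk ε₁ ε') (Wk ε₁ ε')

/-- **`e3Inst` is `e3InstB`** (the semantic bridge: `nbrN_eq`, `accNat_eq_accOfDesc`, `dartLC_eq_dartLCList`). [cite: AroraBarak2009, Thm. 22.15] -/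
theorem e3Inst_eq_e3InstB (ε₁ ε' : ℝ) (ψ : CNF ℕ) : e3Inst ε₁ ε' ψ = e3InstB ε₁ ε' ψ := by
  have hacc : ∀ (v : Fin (N ψ)) (i : Fin (D ψ)), accN ψ v i = accNat (cons ψ) 8 v i := fun v i => (accNat_eq_accOfDesc ψ v i).symm
  have hnbr : ∀ (v : Fin (N ψ)) (i : Fin (D ψ)), nbrN ψ v i = ((graph ψ).nbr v i).val := fun v i => nbrN_eq ψ v i
  unfold e3Inst e3InstB
  by_cases hE : ψ.IsExactWidth 3
  · rw [if_pos hE, if_pos ((exactB_eq_true_iff ψ).2 hE)]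
    by_cases hm : 0 < ψ.length
    · rw [dif_pos hm, if_pos (decide_eq_true hm)]
      have htests : haccTest ψ = haccB (N ψ) (D ψ) (accN ψ) := by
        rw [Bool.eq_iff_iff, haccTest_eq_true_iff, haccB_iff _ _ _ hacc]
      rw [htests]
      split_ifs
      · exact dartLC_eq_dartLCList _ _ _ _ _ _ hnbr hacc _
      · rfl
    · rw [dif_neg hm, if_neg (fun h => hm (of_decide_eq_true h))]
  · rw [if_neg hE, if_neg (fun h => hE ((exactB_eq_true_iff ψ).1 h))]

/-- `e3InstB` on codes (tuple form). [cite: AroraBarak2009, Thm. 22.15] -/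
theorem e3InstBFP (ε₁ ε' : ℝ) : CodeFP cnfE tupE (fun ψ => (e3InstB ε₁ ε' ψ).toTuple) := by
  have hlen : CodeFP cnfE bitE (fun ψ : CNF ℕ => decide (0 < ψ.length)) := (natLt.comp ((const _ 0).pair lengthFP)).congr fun _ => rfl
  have hNO : CodeFP cnfE tupE (fun _ => (constLC (Wk ε₁ ε') (Wk ε₁ ε')).toTuple) := const _ _
  have hYES : CodeFP cnfE tupE (fun _ => (constLC (Wk ε₁ ε') 1).toTuple) := const _ _
  exact (exactBFP.ite (hlen.ite (haccBFP.ite (dartLCListTupleFP (kOf ε₁ ε')) hNO) hYES) hNO).congr fun ψ => by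
    unfold e3InstB; split_ifs <;> rfl

/-- **The one-shot reduction is computed on codes by a polynomial-time function.** [cite: AroraBarak2009, §1.3 and Thm. 22.15] -/
theorem e3Inst_codeFP (ε₁ ε' : ℝ) :
    ∃ f ∈ FP, ∀ ψ : CNF ℕ, f (encodingCNF.encode ψ) = LabelCoverInstance.encoding.encode (e3Inst ε₁ ε' ψ) := by
  obtain ⟨f, hf, h⟩ := e3InstBFP ε₁ ε'
  refine ⟨f, hf, fun ψ => ?_⟩
  rw [cnfE_eq, h, LabelCoverInstance.encoding_encode, e3Inst_eq_e3InstB, tupE_eq]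

/-- **Arora–Barak Thm. 22.15 in the tree's form, from gap-E3SAT hardness alone**: if `gapE3SAT (1/8 - ε₁)` is
NP-hard for some `0 < ε₁ ≤ 1/8` (the PCP theorem in Håstad/Dinur form), then for every `ε > 0` some `W` makes
`gapLabelCover W ε` NP-hard. [cite: AroraBarak2009, Thm. 22.15] -/
theorem isNPHard_gapLabelCover_forall_of_gapE3SAT_hard {ε₁ : ℚ} (hε₁ : 0 < ε₁) (hε₁8 : ε₁ ≤ 1 / 8)
    (hhard : (gapE3SAT (1 / 8 - ε₁)).IsNPHard) : ∀ ε : ℝ, 0 < ε → ∃ W : ℕ, (gapLabelCover W ε).IsNPHard :=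
  isNPHard_gapLabelCover_forall_of_gapE3SAT hε₁ hε₁8 hhard fun ε' _ => e3Inst_codeFP ε₁ ε'

end E3LC

end Expander

end Literature.Computability.Complexity
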